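import Literature.AlgebraicGeometry.Shioda1982.ExceptionalQuadruplesComplete
import HarnessLib

/-!
# Shioda 1982 / Meyer–Neutsch 1981: no exceptional quadruple at the level `N = 468` — kernel sweep, part 4 of 12

Topic `Literature/AlgebraicGeometry/Shioda1982`; companion of `ExceptionalQuadruplesComplete.lean` (search `checkB`, soundness
`tabelleOneCompleteAt_of_chunks`, invariant form `exists_mem_reps_of_isExceptionalQuadruple`, statement `TabelleOneCompleteAt`; sources,
method and framing in its module docstring) and of the series `ExceptionalQuadruplesSweep*.lean` (together: every level `2 ≤ N ≤ 180`
that is not a row of Tabelle 1; `…SweepTwoHundredTwenty.lean`: `N = 220`). THEOREMS only (no definition, no named fact): the same kernel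
search at the single level `N = 468`, which carries NO row of [MeyerNeutsch1981Fermatquadrupel, Tabelle 1] (computer-generated there,
"alle Fermatquadrupel für N ≤ 614 ermittelt", §2 p. 53) and lies above the range `N ≤ 180` of Shioda's table p. 727 — by Aoki's
Theorem C ([Aoki1983], computer-assisted for `181 ≤ m ≤ 672`) there is no exceptional element at any level `> 180`; the files
`ExceptionalQuadruplesSweepFourHundredSixtyEightPartOne.lean`, `ExceptionalQuadruplesSweepFourHundredSixtyEightPartTwo.lean`, `ExceptionalQuadruplesSweepFourHundredSixtyEightPartThree.lean`, `ExceptionalQuadruplesSweepFourHundredSixtyEightPartFour.lean`, `ExceptionalQuadruplesSweepFourHundredSixtyEightPartFive.lean`, `ExceptionalQuadruplesSweepFourHundredSixtyEightPartSix.lean`, `ExceptionalQuadruplesSweepFourHundredSixtyEightPartSeven.lean`, `ExceptionalQuadruplesSweepFourHundredSixtyEightPartEight.lean`, `ExceptionalQuadruplesSweepFourHundredSixtyEightPartNine.lean`, `ExceptionalQuadruplesSweepFourHundredSixtyEightPartTen.lean`, `ExceptionalQuadruplesSweepFourHundredSixtyEightPartEleven.lean`, `ExceptionalQuadruplesSweepFourHundredSixtyEight.lean`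 make the instance `N = 468` a kernel statement. The search at
`N = 468` visits 2874729 candidate triples (`φ(468) − 1 = 143` units each), too many for one elaboration of bounded wall time, so the
chunks of first entries are spread over 12 files: `ExceptionalQuadruplesSweepFourHundredSixtyEightPartOne.lean` — first entries `0 ≤ a < 12` (223773 candidates);
`ExceptionalQuadruplesSweepFourHundredSixtyEightPartTwo.lean` — first entries `12 ≤ a < 25` (251733 candidates);
`ExceptionalQuadruplesSweepFourHundredSixtyEightPartThree.lean` — first entries `25 ≤ a < 37` (237573 candidates);
`ExceptionalQuadruplesSweepFourHundredSixtyEightPartFour.lean` — first entries `37 ≤ a < 49` (239313 candidates);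
`ExceptionalQuadruplesSweepFourHundredSixtyEightPartFive.lean` — first entries `49 ≤ a < 61` (237885 candidates);
`ExceptionalQuadruplesSweepFourHundredSixtyEightPartSix.lean` — first entries `61 ≤ a < 73` (233289 candidates);
`ExceptionalQuadruplesSweepFourHundredSixtyEightPartSeven.lean` — first entries `73 ≤ a < 86` (243869 candidates);
`ExceptionalQuadruplesSweepFourHundredSixtyEightPartEight.lean` — first entries `86 ≤ a < 100` (247818 candidates);
`ExceptionalQuadruplesSweepFourHundredSixtyEightPartNine.lean` — first entries `100 ≤ a < 114` (227548 candidates);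
`ExceptionalQuadruplesSweepFourHundredSixtyEightPartTen.lean` — first entries `114 ≤ a < 131` (241812 candidates);
`ExceptionalQuadruplesSweepFourHundredSixtyEightPartEleven.lean` — first entries `131 ≤ a < 152` (233794 candidates);
`ExceptionalQuadruplesSweepFourHundredSixtyEight.lean` — first entries `152 ≤ a < 468` (256322 candidates); the last one assembles
`completeAt_fourHundredSixtyEight` (every sorted pair-free primitive Hodge 4-multiset mod `468` is standard) and `not_isExceptionalQuadruple_fourHundredSixtyEight`.
WHY THIS LEVEL (cell `pub-hfermat`): `468 = 36·13`, the instance `p = 13` of the family `m = 36p` of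
`HodgeQuadruplesThirtySixPrime.lean` (`classify_hodgeMultiset_thirtySixPrime`, `p ≥ 19`) below its range — a residual prime of the
companion `PicardNumberThirtySixPrime.lean` (`exceptional_thirtySixPrime`). `decide +kernel` only (no `native_decide`).

HONEST FRAMING (cell `pub-hfermat`): explicit algebraic cycles for specific Hodge classes on Fermat/Delsarte varieties; residual open
instances listed; no claim on general Hodge. These classes are algebraic (Lefschetz (1,1)); certified here is only the emptiness of the
exceptional list at this level.

## References
* [MeyerNeutsch1981Fermatquadrupel] W. Meyer, W. Neutsch, *Fermatquadrupel*, Math. Ann. 256 (1981) 51–62, §2 p. 53, Tabelle 1 p. 54 (no row 468).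
* [Shioda1982PicardFermat] T. Shioda, J. Fac. Sci. Univ. Tokyo IA 28 (1982) 725–734, table p. 727 (levels `≤ 180`), Prop. 4 (Q′) p. 729.
* [Aoki1983] N. Aoki, Math. Ann. 266 (1983) 23–54, Thm. C.
-/

namespace Literature.AlgebraicGeometry.Shioda1982

open Literature.AlgebraicGeometry.HodgeTheory

set_option maxHeartbeats 0 in
/-- **The search at `N = 468` passes on the first entries `37 ≤ a < 49`** (part 4 of 12: 12 chunks, 239313 candidate
triples): every visited sorted quadruple of representatives there fails the Hodge test or is standard (`checkB`; `reps 468 = []`).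
[cite: MeyerNeutsch1981Fermatquadrupel, §2 p. 53 ("alle Fermatquadrupel für N ≤ 614 ermittelt") and Tabelle 1 p. 54 (no row 468)]
[cite: Aoki1983, Thm. C] -/
theorem checkB_fourHundredSixtyEight_partFour :
    ∀ p ∈ ([(37, 1), (38, 1), (39, 1), (40, 1), (41, 1), (42, 1), (43, 1), (44, 1), (45, 1), (46, 1), (47, 1), (48, 1)] : List (ℕ × ℕ)), checkB 468 p.1 p.2 = true := by
  intro p hp
  simp only [List.mem_cons, List.not_mem_nil, or_false] at hp
  rcases hp with rfl | rfl | rfl | rfl | rfl | rfl | rfl | rfl | rfl | rfl | rfl | rfl <;> decide +kernel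

end Literature.AlgebraicGeometry.Shioda1982
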